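import Mathlib
import HarnessLib
import Literature.Analysis.FluidPDE.SelfSimilar
import Literature.Analysis.FluidPDE.VectorCalculus
import Literature.Analysis.FluidPDE.RadialCalculus
import Literature.Analysis.FluidPDE.ClassicalSolutionGalilean
import Literature.Analysis.FluidPDE.KNSSRegularityGalilean
import Literature.Analysis.FluidPDE.LerayProfileCalculus
import Literature.Analysis.FluidPDE.ClassicalSolution
import Literature.Analysis.FluidPDE.ClassicalSolutionCalculus
import Literature.Analysis.FluidPDE.SpaceTimeCalculus
import Literature.Analysis.FluidPDE.TaoEnstrophyLocalisation
import Literature.Analysis.UnboundedOperators.HeatKernel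
import Literature.Analysis.FluidPDE.NSBoundedMildOseen

/-!
# K2 line `slicesharp-screw`, stub L4 `stub_decayingSlopeLiouville` — file 2/4: `C²` SPACE–TIME BOOKKEEPING ON THE OPEN SLAB

Cell ns-regularity-ideate, K2 lead nsreg-p7 (helper file, `--supports stmt-NavierStokesRegularity-19708 --as helper`).
For `θ` with `ContDiffOn ℝ 2 (uncurry θ) ((−∞,0) × ℝ³)`: slices are `C²`, the time line has derivative
`∂ₜθ(t,x) = D(uncurry θ)(t,x)(1,0)`, and `t ↦ ∂ₜθ(t,x)`, `t ↦ D(θ t)(x)`, `t ↦ Δ(θ t)(x)` are continuous on `(−∞,0)`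
(the Laplacian through the space–time Hessian: `D²(θ t)(x)(a,b) = D²(uncurry θ)(t,x)((0,b),(0,a))`).  The tree's
`ClassicalSolutionCalculus`/`SpaceTimeCalculus` give these for `C^∞` fields (`IsSmoothSpaceTimeOn`); the registered stub
asks only `C²`, hence this file.

WHAT THIS IS NOT: not a claim about Navier–Stokes regularity — calculus for one registered stub of the K2 line of a door route
(bears_on LADDER-NS N0, rung N0-LocalTubeDoorPoloidal).
-/

noncomputable section

set_option linter.dupNamespace false

namespace Summit.NavierStokesRegularity.NavierStokesRegularity.Theorems.PoloidalWindowDoorPoloidalWindowRigidityDecayingSlopeLiouvilleSlab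

open Set Function Filter Topology Metric InnerProductSpace MeasureTheory
open scoped RealInnerProductSpace Laplacian
open Literature.Analysis Literature.Analysis.FluidPDE

/-! ### Part B — continuity facts for a `C²` space–time scalar on the open slab -/

section Slab

variable {θ : ℝ → (EuclideanSpace ℝ (Fin 3)) → ℝ}

/-- The open slab `(−∞,0) × ℝ³`. -/
theorem isOpen_slab : IsOpen (Iio (0:ℝ) ×ˢ (univ : Set (EuclideanSpace ℝ (Fin 3)))) := isOpen_Iio.prod isOpen_univ

/-- A `C²` space–time scalar is differentiable at every point of the open slab. -/
theorem hasFDerivAt_uncurry (hθ : ContDiffOn ℝ 2 (uncurry θ) (Iio (0:ℝ) ×ˢ univ)) {t : ℝ} (ht : t < 0)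
    (x : (EuclideanSpace ℝ (Fin 3))) : HasFDerivAt (uncurry θ) (fderiv ℝ (uncurry θ) (t, x)) (t, x) :=
  (((hθ (t, x) ⟨ht, mem_univ _⟩).contDiffAt (isOpen_slab.mem_nhds ⟨ht, mem_univ _⟩)).differentiableAt
    (by norm_num)).hasFDerivAt

/-- The first derivative of a `C²` space–time scalar is `C¹` on the open slab. -/
theorem contDiffOn_fderiv_uncurry (hθ : ContDiffOn ℝ 2 (uncurry θ) (Iio (0:ℝ) ×ˢ univ)) :
    ContDiffOn ℝ 1 (fderiv ℝ (uncurry θ)) (Iio (0:ℝ) ×ˢ univ) :=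
  hθ.fderiv_of_isOpen isOpen_slab (by norm_num)

/-- The first derivative of a `C²` space–time scalar is continuous on the open slab. -/
theorem continuousOn_fderiv_uncurry (hθ : ContDiffOn ℝ 2 (uncurry θ) (Iio (0:ℝ) ×ˢ univ)) :
    ContinuousOn (fderiv ℝ (uncurry θ)) (Iio (0:ℝ) ×ˢ univ) :=
  hθ.continuousOn_fderiv_of_isOpen isOpen_slab (by norm_num)

/-- The second derivative of a `C²` space–time scalar is continuous on the open slab. -/
theorem continuousOn_fderiv_fderiv_uncurry (hθ : ContDiffOn ℝ 2 (uncurry θ) (Iio (0:ℝ) ×ˢ univ)) :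
    ContinuousOn (fderiv ℝ (fderiv ℝ (uncurry θ))) (Iio (0:ℝ) ×ˢ univ) :=
  (contDiffOn_fderiv_uncurry hθ).continuousOn_fderiv_of_isOpen isOpen_slab le_rfl

/-- The time line `s ↦ θ s x` has derivative `deriv (θ · x) t = D(uncurry θ)(t,x)(1,0)` at `t < 0`. -/
theorem hasDerivAt_time (hθ : ContDiffOn ℝ 2 (uncurry θ) (Iio (0:ℝ) ×ˢ univ)) {t : ℝ} (ht : t < 0)
    (x : (EuclideanSpace ℝ (Fin 3))) : HasDerivAt (fun s => θ s x) (deriv (fun s => θ s x) t) t :=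
  (FluidPDE.hasDerivAt_timeLine (hasFDerivAt_uncurry hθ ht x)).differentiableAt.hasDerivAt

/-- `deriv (θ · x) t = D(uncurry θ)(t,x)(1,0)` at `t < 0`. -/
theorem deriv_time_eq (hθ : ContDiffOn ℝ 2 (uncurry θ) (Iio (0:ℝ) ×ˢ univ)) {t : ℝ} (ht : t < 0)
    (x : (EuclideanSpace ℝ (Fin 3))) : deriv (fun s => θ s x) t = fderiv ℝ (uncurry θ) (t, x) (1, 0) :=
  (FluidPDE.hasDerivAt_timeLine (hasFDerivAt_uncurry hθ ht x)).deriv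

/-- Continuity of `t ↦ (t, x)` into the slab. -/
theorem continuousOn_pair (x : (EuclideanSpace ℝ (Fin 3))) : ContinuousOn (fun t : ℝ => ((t, x) : ℝ × (EuclideanSpace ℝ (Fin 3)))) (Iio 0) :=
  continuousOn_id.prodMk continuousOn_const

/-- Continuity of `t ↦ ∂ₜθ(t,x)` on `(−∞,0)`. -/
theorem continuousOn_deriv_time (hθ : ContDiffOn ℝ 2 (uncurry θ) (Iio (0:ℝ) ×ˢ univ)) (x : (EuclideanSpace ℝ (Fin 3))) :
    ContinuousOn (fun t => deriv (fun s => θ s x) t) (Iio 0) := by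
  have h1 : ContinuousOn (fun t : ℝ => fderiv ℝ (uncurry θ) (t, x) (1, 0)) (Iio 0) :=
    ((continuousOn_fderiv_uncurry hθ).comp (continuousOn_pair x) fun _ ht => ⟨ht, mem_univ _⟩).clm_apply
      continuousOn_const
  exact h1.congr fun t ht => deriv_time_eq hθ ht x

/-- The slice derivative: `D(θ t)(x) = D(uncurry θ)(t,x) ∘ (0, ·)` at `t < 0`. -/
theorem fderiv_slice_eq (hθ : ContDiffOn ℝ 2 (uncurry θ) (Iio (0:ℝ) ×ˢ univ)) {t : ℝ} (ht : t < 0)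
    (x : (EuclideanSpace ℝ (Fin 3))) : fderiv ℝ (θ t) x = (fderiv ℝ (uncurry θ) (t, x)).comp (ContinuousLinearMap.inr ℝ ℝ (EuclideanSpace ℝ (Fin 3))) :=
  (FluidPDE.hasFDerivAt_slice (hasFDerivAt_uncurry hθ ht x)).fderiv

/-- Continuity of `t ↦ D(θ t)(x)` on `(−∞,0)`. -/
theorem continuousOn_fderiv_slice (hθ : ContDiffOn ℝ 2 (uncurry θ) (Iio (0:ℝ) ×ˢ univ)) (x : (EuclideanSpace ℝ (Fin 3))) :
    ContinuousOn (fun t => fderiv ℝ (θ t) x) (Iio 0) := by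
  have h1 : ContinuousOn (fun t : ℝ => (fderiv ℝ (uncurry θ) (t, x)).comp (ContinuousLinearMap.inr ℝ ℝ (EuclideanSpace ℝ (Fin 3))))
      (Iio 0) :=
    ((ContinuousLinearMap.compL ℝ (EuclideanSpace ℝ (Fin 3)) (ℝ × (EuclideanSpace ℝ (Fin 3))) ℝ).flip (ContinuousLinearMap.inr ℝ ℝ (EuclideanSpace ℝ (Fin 3)))).continuous.comp_continuousOn
      ((continuousOn_fderiv_uncurry hθ).comp (continuousOn_pair x) fun _ ht => ⟨ht, mem_univ _⟩)
  exact h1.congr fun t ht => fderiv_slice_eq hθ ht x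

/-- Slices of a `C²` space–time scalar are `C²`. -/
theorem contDiff_slice_two (hθ : ContDiffOn ℝ 2 (uncurry θ) (Iio (0:ℝ) ×ˢ univ)) {t : ℝ} (ht : t < 0) :
    ContDiff ℝ 2 (θ t) := by
  have hc : ContDiff ℝ 2 (fun x : (EuclideanSpace ℝ (Fin 3)) => ((t, x) : ℝ × (EuclideanSpace ℝ (Fin 3)))) := contDiff_const.prodMk contDiff_id
  have := hθ.comp_contDiff hc (fun x => ⟨ht, mem_univ x⟩)
  simpa [Function.comp_def] using this

/-- The second slice derivative from the space–time Hessian: for `t < 0`,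
`D(y ↦ D(uncurry θ)(t,y)(0,a))(x) b = D²(uncurry θ)(t,x)(0,b)(0,a)`. -/
theorem fderiv_fderiv_slice_apply (hθ : ContDiffOn ℝ 2 (uncurry θ) (Iio (0:ℝ) ×ˢ univ)) {t : ℝ} (ht : t < 0)
    (x a b : (EuclideanSpace ℝ (Fin 3))) :
    fderiv ℝ (fun y => fderiv ℝ (θ t) y a) x b = fderiv ℝ (fderiv ℝ (uncurry θ)) (t, x) (0, b) (0, a) := by
  -- `y ↦ D(θ t)(y) a = D(uncurry θ)(t, y) (0, a)`
  have h1 : (fun y => fderiv ℝ (θ t) y a) = fun y => fderiv ℝ (uncurry θ) (t, y) (0, a) := by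
    funext y; rw [fderiv_slice_eq hθ ht y]; simp
  rw [h1]
  -- differentiate the slice of the `C¹` map `D(uncurry θ)`
  have hD : HasFDerivAt (fderiv ℝ (uncurry θ)) (fderiv ℝ (fderiv ℝ (uncurry θ)) (t, x)) (t, x) :=
    ((((contDiffOn_fderiv_uncurry hθ) (t, x) ⟨ht, mem_univ _⟩).contDiffAt
      (isOpen_slab.mem_nhds ⟨ht, mem_univ _⟩)).differentiableAt one_ne_zero).hasFDerivAt
  have h2 : HasFDerivAt (fun y : (EuclideanSpace ℝ (Fin 3)) => fderiv ℝ (uncurry θ) (t, y))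
      ((fderiv ℝ (fderiv ℝ (uncurry θ)) (t, x)).comp (ContinuousLinearMap.inr ℝ ℝ (EuclideanSpace ℝ (Fin 3)))) x :=
    FluidPDE.hasFDerivAt_slice (w := fun s y => fderiv ℝ (uncurry θ) (s, y)) hD
  have h3 : HasFDerivAt ((⇑(ContinuousLinearMap.apply ℝ ℝ ((0 : ℝ), a))) ∘ fun y : (EuclideanSpace ℝ (Fin 3)) => fderiv ℝ (uncurry θ) (t, y))
      ((ContinuousLinearMap.apply ℝ ℝ ((0 : ℝ), a)).comp
        ((fderiv ℝ (fderiv ℝ (uncurry θ)) (t, x)).comp (ContinuousLinearMap.inr ℝ ℝ (EuclideanSpace ℝ (Fin 3))))) x :=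
    (ContinuousLinearMap.apply ℝ ℝ ((0 : ℝ), a)).hasFDerivAt.comp x h2
  have h4 : (fun y : (EuclideanSpace ℝ (Fin 3)) => fderiv ℝ (uncurry θ) (t, y) (0, a)) =
      ((⇑(ContinuousLinearMap.apply ℝ ℝ ((0 : ℝ), a))) ∘ fun y : (EuclideanSpace ℝ (Fin 3)) => fderiv ℝ (uncurry θ) (t, y)) := rfl
  rw [h4, h3.fderiv]
  simp

/-- Continuity of `t ↦ Δ(θ t)(x)` on `(−∞,0)`. -/
theorem continuousOn_laplacian_slice (hθ : ContDiffOn ℝ 2 (uncurry θ) (Iio (0:ℝ) ×ˢ univ)) (x : (EuclideanSpace ℝ (Fin 3))) :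
    ContinuousOn (fun t => (Δ (θ t)) x) (Iio 0) := by
  set b := EuclideanSpace.basisFun (Fin 3) ℝ
  have h1 : ∀ t < (0:ℝ), (Δ (θ t)) x = ∑ i, fderiv ℝ (fderiv ℝ (uncurry θ)) (t, x) (0, b i) (0, b i) := by
    intro t ht
    rw [laplacian_eq_sum_fderiv_fderiv b (contDiff_slice_two hθ ht) x]
    exact Finset.sum_congr rfl fun i _ => fderiv_fderiv_slice_apply hθ ht x (b i) (b i)
  have h2 : ContinuousOn (fun t : ℝ => ∑ i, fderiv ℝ (fderiv ℝ (uncurry θ)) (t, x) (0, b i) (0, b i)) (Iio 0) := by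
    refine continuousOn_finsetSum _ fun i _ => ?_
    have hc : ContinuousOn (fun t : ℝ => fderiv ℝ (fderiv ℝ (uncurry θ)) (t, x)) (Iio 0) :=
      (continuousOn_fderiv_fderiv_uncurry hθ).comp (continuousOn_pair x) fun _ ht => ⟨ht, mem_univ _⟩
    exact (hc.clm_apply continuousOn_const).clm_apply continuousOn_const
  exact h2.congr fun t ht => h1 t ht

/-- Continuity of `t ↦ θ t x` on `(−∞,0)`. -/
theorem continuousOn_time (hθ : ContDiffOn ℝ 2 (uncurry θ) (Iio (0:ℝ) ×ˢ univ)) (x : (EuclideanSpace ℝ (Fin 3))) :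
    ContinuousOn (fun t => θ t x) (Iio 0) :=
  hθ.continuousOn.comp (continuousOn_pair x) fun _ ht => ⟨ht, mem_univ _⟩

end Slab

end Summit.NavierStokesRegularity.NavierStokesRegularity.Theorems.PoloidalWindowDoorPoloidalWindowRigidityDecayingSlopeLiouvilleSlab

end
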